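import Summits.HodgeConjecture.HodgeConjecture.Theorems.EndoscopicMiddleDegreeOrthogonalSplit

/-!
# Crux `IsotypicMiddleClassesAlgebraic` (stmt-HodgeConjecture-14301), line `IdeatorTwoSketch` (Line B,
reshaped) — stub `stub_inversion`: the INVERSION LEMMA (engine, `X`-side)

For `X` smooth projective of dimension `2n` (`n = m + 1`) and a set `S` of ALGEBRAIC middle classes,
every rational Hodge `(n,n)`-class `h` which is cup-orthogonal to every rational Hodge `(n,n)`-class
`k` that is cup-orthogonal to `S` is algebraic — the relative form of Brosnan–Fang–Nie–Pearlstein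
2009 §6 (6.1) ("the Hodge conjecture for `Y` is equivalent to the assertion that the perpendicular
subspace `(Alg^k Y)^⊥ ⊂ Hdg^{dim Y - k} Y` is zero"). CONDITIONAL on two named facts, taken as
explicit hypotheses exactly as the registered stub states them: Grothendieck's coniveau inclusion
`Grothendieck1969_supportedClasses_le_hodgeConiveau` (algebraic classes are of type `(n,n)`) and the
Kähler package `hardLefschetz_hodgeRiemann (2n) X` (hard Lefschetz + Hodge–Riemann for the hyperplane
class, whence the perfect pairing (6.1) by `hodgeClasses_cupPairing_nondegenerate_of_hodgeRiemann`).

PROOF (linear algebra over `ℚ`, in the style of `mem_sup_span_orthogonal`). Replace `S` by the set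
`Srat` of RATIONAL algebraic classes (`Nⁿ = span Srat`, `supportedClasses_le_span_isRationalClass`,
so the hypothesis for `S` implies the one for `Srat`). Fix a Hodge model `A`; let `Hd` be the
rational classes of type `(n,n)` in `A`, `b` a finite `ℂ`-basis of `span Hd` inside `Hd`, `t` a finite
`ℂ`-basis of `span Srat` inside `Srat ⊆ Hd`, and `ρ ≠ 0` a rational generator of the line
`H^{4n}(X(ℂ); ℂ)`. All pairings `bⱼ ∪ t_l = σ_{lj} ρ`, `h ∪ bⱼ = θⱼ ρ` of rational classes have
RATIONAL coefficients. For a rational vector `q` with `Σⱼ σ_{lj} qⱼ = 0` for all `l`, the rational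
Hodge class `k_q = Σ qⱼ bⱼ` is orthogonal to every `t_l`, hence to `S`, hence `h ∪ k_q = 0`, i.e.
`Σ θⱼ qⱼ = 0`: the functional `q` annihilating the `σ_l` annihilates `θ`, so `θ ∈ span_ℚ {σ_l}`
(`Subspace.forall_mem_dualAnnihilator_apply_eq_zero_iff`), say `θ = Σ λ_l σ_l`. Then
`x = h - Σ λ_l t_l` is a rational Hodge class with `x ∪ bⱼ = 0` for all `j` (graded commutativity in
even degrees), hence orthogonal to all of `Hd`, hence `x = 0` by the perfect pairing (6.1): `h` is a
combination of the algebraic `t_l`.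
-/

noncomputable section

-- `Summit.HodgeConjecture.HodgeConjecture.Theorems` is the mandated namespace (single-problem summit:
-- Problem = Summit), flagged by `linter.dupNamespace`; restated for stand-alone elaboration.
set_option linter.dupNamespace false

open CategoryTheory MonoidalCategory CartesianMonoidalCategory
open Literature.AlgebraicGeometry Literature.AlgebraicGeometry.Motives
open Literature.AlgebraicGeometry.HodgeTheory Literature.AlgebraicTopology.SingularHomology
open scoped Manifold

namespace Summit.HodgeConjecture.HodgeConjecture.Theorems

/-- **Rational annihilator lemma.** For finitely many rational vectors `σ l : ι → ℚ` and a rational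
vector `θ`: if every rational `q` with `Σⱼ σ l j * q j = 0` for all `l` also has `Σⱼ θ j * q j = 0`,
then `θ` is a rational combination of the `σ l` (double annihilator in the finite-dimensional
`ℚ`-space `ι → ℚ`, `Subspace.forall_mem_dualAnnihilator_apply_eq_zero_iff`). -/
theorem exists_eq_sum_smul_of_forall_annihilator {ι L : Type*} [Fintype ι] [Fintype L]
    (σ : L → ι → ℚ) (θ : ι → ℚ)
    (hann : ∀ q : ι → ℚ, (∀ l, ∑ j, σ l j * q j = 0) → ∑ j, θ j * q j = 0) :
    ∃ lam : L → ℚ, θ = ∑ l, lam l • σ l := by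
  classical
  have hmem : θ ∈ Submodule.span ℚ (Set.range σ) := by
    rw [← Subspace.forall_mem_dualAnnihilator_apply_eq_zero_iff]
    intro φ hφ
    -- the functional `φ` is `v ↦ Σⱼ v j * q j` with `q j = φ (Pi.single j 1)`
    have hφv : ∀ v : ι → ℚ, φ v = ∑ j, v j * φ (Pi.single j 1) := by
      intro v
      conv_lhs => rw [pi_eq_sum_univ' v]
      rw [map_sum]
      exact Finset.sum_congr rfl fun j _ ↦ by rw [map_smul, smul_eq_mul]
    rw [hφv]
    refine hann (fun j ↦ φ (Pi.single j 1)) fun l ↦ ?_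
    rw [← hφv]
    exact (Submodule.mem_dualAnnihilator φ).1 hφ _ (Submodule.subset_span (Set.mem_range_self l))
  obtain ⟨lam, hlam⟩ := (Submodule.mem_span_range_iff_exists_fun ℚ).1 hmem
  exact ⟨lam, hlam.symm⟩

variable {m : ℕ} {X : SchemeOver ℂ}

/-- Rational classes are closed under subtraction of rational combinations. [folklore] -/
theorem isRationalClass_sub_sum_smul {k : ℕ} {ι : Type*} (s : Finset ι)
    {h : complexBetti X k} (hh : IsRationalClass h) {t : ι → complexBetti X k}
    (ht : ∀ i, IsRationalClass (t i)) (lam : ι → ℚ) :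
    IsRationalClass (h - ∑ i ∈ s, ((lam i : ℚ) : ℂ) • t i) := by
  have hneg : h - ∑ i ∈ s, ((lam i : ℚ) : ℂ) • t i =
      h + ∑ i ∈ s, (((-lam i : ℚ) : ℚ) : ℂ) • t i := by
    rw [sub_eq_add_neg, ← Finset.sum_neg_distrib]
    congr 1
    refine Finset.sum_congr rfl fun i _ ↦ ?_
    rw [Rat.cast_neg, neg_smul]
  rw [hneg]
  exact hh.add (IsRationalClass.sum_smul s ht _)

/-- **Stub `stub_inversion` of line B (the inversion lemma; relative BFNP 2009 §6 (6.1)).** Granted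
Grothendieck's coniveau inclusion and the Kähler package on the `2n`-fold `X` (`n = m + 1`): a
rational Hodge `(n,n)`-class `h` which is cup-orthogonal to every rational Hodge `(n,n)`-class that
is cup-orthogonal to a set `S` of algebraic classes is itself algebraic (indeed a `ℚ`-combination of
rational algebraic classes). See the module docstring for the proof.
[cite: BrosnanFangNiePearlstein2009, §6 (6.1)] [cite: VoisinHodgeI2002, Thm. 6.25, Thm. 6.32 and §7.1.2] -/
theorem stub_inversion (hG : Grothendieck1969_supportedClasses_le_hodgeConiveau)
    (m : ℕ) (X : SchemeOver ℂ) (hX : IsSmoothProjective (2 * (m + 1)) X)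
    (hK : hardLefschetz_hodgeRiemann (2 * (m + 1)) X)
    (S : Set (complexBetti X (2 * (m + 1)))) (hS : S ⊆ algebraicClasses X (m + 1))
    (h : complexBetti X (2 * (m + 1))) (hhQ : IsRationalClass h)
    (hhT : IsOfHodgeType (2 * (m + 1)) X (2 * (m + 1)) (m + 1) (m + 1) h)
    (horth : ∀ k : complexBetti X (2 * (m + 1)), IsRationalClass k →
      IsOfHodgeType (2 * (m + 1)) X (2 * (m + 1)) (m + 1) (m + 1) k →
      (∀ s ∈ S, cupProduct (two_mul_add_two_mul (m + 1) (m + 1)) k s = 0) →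
      cupProduct (two_mul_add_two_mul (m + 1) (m + 1)) h k = 0) :
    h ∈ algebraicClasses X (m + 1) := by
  classical
  have hI : hodgePQ_independent_of_hodgeModel := hodgePQ_independent_of_hodgeModel_holds
  haveI := finite_complexBetti hX (2 * (m + 1))
  obtain ⟨A, hhA⟩ := hhT
  set B : complexBetti X (2 * (m + 1)) →ₗ[ℂ] complexBetti X (2 * (m + 1)) →ₗ[ℂ]
      complexBetti X (2 * ((m + 1) + (m + 1))) := cupProduct (two_mul_add_two_mul (m + 1) (m + 1))
    with hBdef
  -- graded commutativity in even degrees: `B` is symmetric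
  have hsymm : ∀ a c : complexBetti X (2 * (m + 1)), B a c = B c a := fun a c ↦ by
    rw [hBdef, cupProduct_gradedComm_holds ℂ (ComplexPoints X) (two_mul_add_two_mul (m + 1) (m + 1))
      (two_mul_add_two_mul (m + 1) (m + 1)) a c, Even.neg_one_pow ⟨2 * (m + 1) * (m + 1), by ring⟩,
      one_smul]
  -- the rational Hodge `(n,n)`-classes, read in the model `A`
  set Hd : Set (complexBetti X (2 * (m + 1))) := {x | IsRationalClass x ∧
      A.pullback (2 * (m + 1)) x ∈ A.hodgePQ (2 * (m + 1)) (m + 1) (m + 1)} with hHddef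
  have hHdT : ∀ x ∈ Hd, IsOfHodgeType (2 * (m + 1)) X (2 * (m + 1)) (m + 1) (m + 1) x :=
    fun x hx ↦ ⟨A, hx.2⟩
  have hTHd : ∀ x : complexBetti X (2 * (m + 1)), IsRationalClass x →
      IsOfHodgeType (2 * (m + 1)) X (2 * (m + 1)) (m + 1) (m + 1) x → x ∈ Hd :=
    fun x hQ hT ↦ ⟨hQ, (hI.isOfHodgeType_iff hX A).1 hT⟩
  -- the perfect pairing (6.1) on `Hd` from the Kähler package
  obtain ⟨Λ, hHR⟩ := hK hX
  have P := Λ.hodgeClasses_cupPairing_nondegenerate_of_hodgeRiemann hI hHR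
  have hnondeg : ∀ x ∈ Hd, (∀ y ∈ Hd, B x y = 0) → x = 0 := by
    intro x hx hxy
    by_contra hx0
    obtain ⟨a, haQ, haT, hne⟩ := P hX (2 * ((m + 1) + (m + 1))) (by omega)
      (two_mul_add_two_mul (m + 1) (m + 1)) x hx.1 (hHdT x hx) hx0
    exact hne (hxy a (hTHd a haQ haT))
  -- the RATIONAL algebraic classes; `Nⁿ = span Srat`; `Srat ⊆ Hd` (Grothendieck)
  set Srat : Set (complexBetti X (2 * (m + 1))) :=
    {x | IsRationalClass x ∧ x ∈ algebraicClasses X (m + 1)} with hSratdef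
  have hAlg_le : algebraicClasses X (m + 1) ≤ Submodule.span ℂ Srat :=
    supportedClasses_le_span_isRationalClass hX (2 * (m + 1)) (m + 1)
  have hSrat_Hd : Srat ⊆ Hd :=
    fun x hx ↦ ⟨hx.1, pullback_mem_hodgePQ_of_mem_supportedClasses hG hX A hx.2⟩
  -- finite `ℂ`-bases `b` of `span Hd` inside `Hd` and `t` of `span Srat` inside `Srat`
  obtain ⟨b, hbHd, hbspan, hbli⟩ := exists_linearIndependent ℂ Hd
  have hbfin : b.Finite := hbli.set_finite_of_isNoetherian
  haveI : Fintype b := hbfin.fintype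
  obtain ⟨t, htS, htspan, htli⟩ := exists_linearIndependent ℂ Srat
  have htfin : t.Finite := htli.set_finite_of_isNoetherian
  haveI : Fintype t := htfin.fintype
  have hbQ : ∀ j : b, IsRationalClass (j : complexBetti X (2 * (m + 1))) := fun j ↦ (hbHd j.2).1
  have hbA : ∀ j : b, A.pullback (2 * (m + 1)) (j : complexBetti X (2 * (m + 1))) ∈
      A.hodgePQ (2 * (m + 1)) (m + 1) (m + 1) := fun j ↦ (hbHd j.2).2
  have htQ : ∀ l : t, IsRationalClass (l : complexBetti X (2 * (m + 1))) := fun l ↦ (htS l.2).1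
  have htA : ∀ l : t, A.pullback (2 * (m + 1)) (l : complexBetti X (2 * (m + 1))) ∈
      A.hodgePQ (2 * (m + 1)) (m + 1) (m + 1) := fun l ↦ (hSrat_Hd (htS l.2)).2
  have htalg : ∀ l : t, (l : complexBetti X (2 * (m + 1))) ∈ algebraicClasses X (m + 1) :=
    fun l ↦ (htS l.2).2
  -- the top line and a rational generator `ρ`
  have htop : Module.finrank ℂ (complexBetti X (2 * ((m + 1) + (m + 1)))) = 1 := by
    rw [show 2 * ((m + 1) + (m + 1)) = 2 * (2 * (m + 1)) by ring]
    exact finrank_complexBetti_two_mul_eq_one hX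
  obtain ⟨ρ, hρQ, hρ0⟩ : ∃ ρ : complexBetti X (2 * ((m + 1) + (m + 1))), IsRationalClass ρ ∧ ρ ≠ 0 := by
    by_contra hc
    push Not at hc
    have hbot : Submodule.span ℂ {x : complexBetti X (2 * ((m + 1) + (m + 1))) | IsRationalClass x} = ⊥ :=
      Submodule.span_eq_bot.2 hc
    have htop' := span_isRationalClass_eq_top_of_isSmoothProjective_holds _ X hX (2 * ((m + 1) + (m + 1)))
    rw [hbot] at htop'
    haveI : Nontrivial (complexBetti X (2 * ((m + 1) + (m + 1)))) :=
      Module.nontrivial_of_finrank_eq_succ htop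
    exact bot_ne_top htop'
  have hline : ∀ w : complexBetti X (2 * ((m + 1) + (m + 1))), IsRationalClass w →
      ∃ q : ℚ, w = ((q : ℚ) : ℂ) • ρ :=
    fun w hw ↦ exists_eq_ratCast_smul_of_isRationalClass htop hρQ hρ0 hw
  have hρinj : ∀ q q' : ℚ, ((q : ℚ) : ℂ) • ρ = ((q' : ℚ) : ℂ) • ρ → q = q' := by
    intro q q' hqq'
    have h1 : (((q : ℚ) : ℂ) - ((q' : ℚ) : ℂ)) • ρ = 0 := by rw [sub_smul, hqq', sub_self]
    have h2 : ((q : ℚ) : ℂ) - ((q' : ℚ) : ℂ) = 0 := (smul_eq_zero.1 h1).resolve_right hρ0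
    exact_mod_cast sub_eq_zero.1 h2
  -- rational pairing coefficients: `bⱼ ∪ t_l = σ l j • ρ`, `h ∪ bⱼ = θ j • ρ`
  choose σ hσ using fun (l : t) (j : b) ↦ hline _ ((hbQ j).cup (two_mul_add_two_mul (m + 1) (m + 1)) (htQ l))
  choose θ hθ using fun j : b ↦ hline _ (hhQ.cup (two_mul_add_two_mul (m + 1) (m + 1)) (hbQ j))
  -- orthogonality to the basis `b` is orthogonality to `Hd`
  have horthHd : ∀ e : complexBetti X (2 * (m + 1)),
      (∀ j : b, B e (j : complexBetti X (2 * (m + 1))) = 0) → ∀ y ∈ Hd, B e y = 0 := by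
    intro e he y hy
    have hy' : y ∈ Submodule.span ℂ b := by rw [hbspan]; exact Submodule.subset_span hy
    exact LinearMap.mem_ker.1 ((Submodule.span_le (p := LinearMap.ker (B e))).2
      (fun z hz ↦ LinearMap.mem_ker.2 (he ⟨z, hz⟩)) hy')
  -- orthogonality to the basis `t` is orthogonality to `S`
  have horthS : ∀ e : complexBetti X (2 * (m + 1)),
      (∀ l : t, B e (l : complexBetti X (2 * (m + 1))) = 0) → ∀ s ∈ S, B e s = 0 := by
    intro e he s hs
    have hs' : s ∈ Submodule.span ℂ t := by rw [htspan]; exact hAlg_le (hS hs)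
    exact LinearMap.mem_ker.1 ((Submodule.span_le (p := LinearMap.ker (B e))).2
      (fun z hz ↦ LinearMap.mem_ker.2 (he ⟨z, hz⟩)) hs')
  -- the annihilator hypothesis of the rational annihilator lemma
  have hann : ∀ q : b → ℚ, (∀ l : t, ∑ j, σ l j * q j = 0) → ∑ j, θ j * q j = 0 := by
    intro q hq
    -- the rational Hodge class `k_q = Σ qⱼ bⱼ`
    set kq : complexBetti X (2 * (m + 1)) := ∑ j, ((q j : ℚ) : ℂ) • (j : complexBetti X (2 * (m + 1)))
      with hkqdef
    have hkqQ : IsRationalClass kq := IsRationalClass.sum_smul Finset.univ hbQ q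
    have hkqA : A.pullback (2 * (m + 1)) kq ∈ A.hodgePQ (2 * (m + 1)) (m + 1) (m + 1) := by
      rw [hkqdef, map_sum]
      exact Submodule.sum_mem _ fun j _ ↦ by rw [map_smul]; exact Submodule.smul_mem _ _ (hbA j)
    -- `k_q ∪ t_l = (Σⱼ σ l j qⱼ) • ρ = 0`
    have hkt : ∀ l : t, B kq (l : complexBetti X (2 * (m + 1))) = 0 := by
      intro l
      have hsum : B kq (l : complexBetti X (2 * (m + 1))) = (((∑ j, σ l j * q j : ℚ) : ℚ) : ℂ) • ρ := by
        rw [hkqdef, map_sum, LinearMap.sum_apply, Rat.cast_sum, Finset.sum_smul]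
        refine Finset.sum_congr rfl fun j _ ↦ ?_
        rw [map_smul, LinearMap.smul_apply, hσ l j, smul_smul, Rat.cast_mul]
        congr 1
        exact mul_comm _ _
      rw [hsum, hq l, Rat.cast_zero, zero_smul]
    -- hence `h ∪ k_q = 0`, i.e. `Σⱼ θⱼ qⱼ = 0`
    have h0 : B h kq = 0 := horth kq hkqQ ⟨A, hkqA⟩ (horthS kq hkt)
    have hsum : B h kq = (((∑ j, θ j * q j : ℚ) : ℚ) : ℂ) • ρ := by
      rw [hkqdef, map_sum, Rat.cast_sum, Finset.sum_smul]
      refine Finset.sum_congr rfl fun j _ ↦ ?_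
      rw [map_smul, hθ j, smul_smul, Rat.cast_mul]
      congr 1
      exact mul_comm _ _
    apply hρinj
    rw [← hsum, h0, Rat.cast_zero, zero_smul]
  -- so `θ = Σ_l λ_l σ_l`
  obtain ⟨lam, hlam⟩ := exists_eq_sum_smul_of_forall_annihilator σ θ hann
  -- the rational Hodge class `x = h - Σ λ_l t_l` is orthogonal to `Hd`, hence zero
  set x : complexBetti X (2 * (m + 1)) :=
    h - ∑ l, ((lam l : ℚ) : ℂ) • (l : complexBetti X (2 * (m + 1))) with hxdef
  have hxQ : IsRationalClass x := isRationalClass_sub_sum_smul Finset.univ hhQ htQ lam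
  have hxA : A.pullback (2 * (m + 1)) x ∈ A.hodgePQ (2 * (m + 1)) (m + 1) (m + 1) := by
    rw [hxdef, map_sub, map_sum]
    refine Submodule.sub_mem _ hhA (Submodule.sum_mem _ fun l _ ↦ ?_)
    rw [map_smul]
    exact Submodule.smul_mem _ _ (htA l)
  have hxb : ∀ j : b, B x (j : complexBetti X (2 * (m + 1))) = 0 := by
    intro j
    have h1 : B h (j : complexBetti X (2 * (m + 1))) = ((θ j : ℚ) : ℂ) • ρ := hθ j
    have h2 : B (∑ l, ((lam l : ℚ) : ℂ) • (l : complexBetti X (2 * (m + 1))))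
        (j : complexBetti X (2 * (m + 1))) = (((∑ l, lam l * σ l j : ℚ) : ℚ) : ℂ) • ρ := by
      rw [map_sum, LinearMap.sum_apply, Rat.cast_sum, Finset.sum_smul]
      refine Finset.sum_congr rfl fun l _ ↦ ?_
      rw [map_smul, LinearMap.smul_apply, hsymm, hσ l j, smul_smul, Rat.cast_mul]
    have h3 : θ j = ∑ l, lam l * σ l j := by
      have := congrFun hlam j
      simpa only [Finset.sum_apply, Pi.smul_apply, smul_eq_mul] using this
    rw [hxdef, map_sub, LinearMap.sub_apply, h1, h2, ← h3, sub_self]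
  have hx0 : x = 0 := hnondeg x ⟨hxQ, hxA⟩ (horthHd x hxb)
  -- conclude: `h = Σ λ_l t_l` is algebraic
  have hh : h = ∑ l, ((lam l : ℚ) : ℂ) • (l : complexBetti X (2 * (m + 1))) := by
    rw [← sub_eq_zero]; exact hx0
  rw [hh]
  exact Submodule.sum_mem _ fun l _ ↦ Submodule.smul_mem _ _ (htalg l)

end Summit.HodgeConjecture.HodgeConjecture.Theorems

end
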